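import Summits.Ventures.HodgeRepro2.AntidiagonalReflectionFamily

/-!
# TiltHeckeMultiCoset — the tilt involution `δ₄ = −r_{v_4}` does NOT normalise `Γ_N` for odd `N`: an explicit
unipotent `g ∈ Γ_N` with `δ₄ g δ₄⁻¹ ∉ Γ_N`, so `T_{δ₄}` on the weight-`k` forms for `Γ_N` is a genuinely
multi-coset Hecke operator (p2 annex row 161)

Cell pub-hodge-repro2, Tier 5 kernel annex (seat p2, Shimura-data / Hecke side). Four definitions
(`unipotentWitness`, `unipotentWitnessInv`, `unipotentWitnessGL`, `tiltInvolutionFour`), the rest proof lane.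
§8(d): uses an L-value-free non-vanishing device: NO.

For the quasi-split model `H_u = antidiag(1, u, 1)` (see the caveat below) with `u ∈ 𝒪_K` real and the standard
lattice `𝒪_K³`:
`g = [[1, −2uN, −2uN²], [0, 1, 2N], [0, 0, 1]]` lies in `SU(H_u)(K)` (`g* H_u g = H_u`, `det g = 1`), has
integral entries together with its inverse, and is `≡ 1 mod N` (`g = 1 + N·M`, `M` integral), hence
`g ∈ Γ_N` (`unipotentWitnessGL_mem_shimuraLevel`). Conjugating by the tilt involution
`δ₄ = tiltInvolutionFour = −r_{v_4}` of row 155 gives `δ₄ g δ₄⁻¹ = [[1,0,0],[N/2,1,0],[−uN²/8, −uN/2, 1]]`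
(`neg_tiltReflection_four_conj_unipotentWitness`), whose `(1,0)` entry `N/2` is NOT an algebraic integer when
`N` is odd (`not_isIntegral_half_of_odd`): `δ₄ g δ₄⁻¹ ∉ Γ_N`
(`tiltInvolutionFour_conj_unipotentWitnessGL_not_mem_shimuraLevel`). Consequences: `g ∉ S_{δ₄} = Γ_N ∩ δ₄⁻¹Γ_Nδ₄`
(`unipotentWitnessGL_not_mem_heckeSubgroup`), `S_{δ₄} ≠ Γ_N` (`heckeSubgroup_tiltInvolutionFour_ne`), the
Hecke quotient `Γ_N / S_{δ₄}` is NONTRIVIAL (`nontrivial_heckeQuotient_tiltInvolutionFour`), has at least two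
elements (`two_le_card_heckeQuotient_tiltInvolutionFour`) and index `[Γ_N : S_{δ₄}] ≥ 2`
(`one_lt_index_heckeSubgroup_tiltInvolutionFour`): the Hecke operator `T_{δ₄}` of rows 147/155 (with
`δ₄⁻¹ ∈ Γ_N δ₄ Γ_N`, the double-coset condition under which `T_δ` is self-adjoint wherever the compact-quotient
Petersson space of rows 126–149 is available) is a sum of at least two slashes, in contrast with the
single-slash Atkin–Lehner involutions of rows 153–154 (elements normalising `Γ_N`). Packaged:
`exists_involution_multiCoset_hecke` — an involution `δ ∈ SU(H_u)(K)` with `δ⁻¹ ∈ Γ_N δ Γ_N` and a nontrivial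
Hecke quotient. CAVEAT (row 163): `antidiag(1,u,1)` is the quasi-split (isotropic) model, so `Γ_N\𝔹²` is
NOT compact and these are group-level / ball-level statements; they do not instantiate the Petersson-space
theorems.

No `sorry`; `#print axioms` ⊆ {propext, Classical.choice, Quot.sound}.
-/

namespace Summit.Ventures.HodgeRepro2.ShimuraData

open Matrix

variable {K : Type*} [Field K]

/-- The unipotent `g = [[1, −2uN, −2uN²], [0, 1, 2N], [0, 0, 1]]`. -/
def unipotentWitness (u : K) (N : ℕ) : Matrix (Fin 3) (Fin 3) K :=
  !![1, -2 * u * N, -2 * u * N ^ 2; 0, 1, 2 * N; 0, 0, 1]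

/-- The inverse `g⁻¹ = [[1, 2uN, −2uN²], [0, 1, −2N], [0, 0, 1]]`. -/
def unipotentWitnessInv (u : K) (N : ℕ) : Matrix (Fin 3) (Fin 3) K :=
  !![1, 2 * u * N, -2 * u * N ^ 2; 0, 1, -(2 * N); 0, 0, 1]

/-- `g g⁻¹ = 1`. -/
theorem unipotentWitness_mul_inv (u : K) (N : ℕ) :
    unipotentWitness u N * unipotentWitnessInv u N = 1 := by
  ext i j
  fin_cases i <;> fin_cases j <;>
    simp [unipotentWitness, unipotentWitnessInv, Matrix.mul_apply, Fin.sum_univ_three]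
  ring

/-- `g⁻¹ g = 1`. -/
theorem unipotentWitnessInv_mul (u : K) (N : ℕ) :
    unipotentWitnessInv u N * unipotentWitness u N = 1 := by
  ext i j
  fin_cases i <;> fin_cases j <;>
    simp [unipotentWitness, unipotentWitnessInv, Matrix.mul_apply, Fin.sum_univ_three]
  ring

/-- `g` as an element of `GL₃(K)`. -/
def unipotentWitnessGL (u : K) (N : ℕ) : GL (Fin 3) K :=
  ⟨unipotentWitness u N, unipotentWitnessInv u N, unipotentWitness_mul_inv u N,
    unipotentWitnessInv_mul u N⟩

/-- The matrix of `unipotentWitnessGL`. -/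
@[simp] theorem coe_unipotentWitnessGL (u : K) (N : ℕ) :
    (unipotentWitnessGL u N : Matrix (Fin 3) (Fin 3) K) = unipotentWitness u N := rfl

/-- The matrix of `(unipotentWitnessGL)⁻¹`. -/
@[simp] theorem coe_unipotentWitnessGL_inv (u : K) (N : ℕ) :
    ((unipotentWitnessGL u N)⁻¹ : GL (Fin 3) K).val = unipotentWitnessInv u N := rfl

/-- `det g = 1`. -/
theorem det_unipotentWitness (u : K) (N : ℕ) : (unipotentWitness u N).det = 1 := by
  simp [unipotentWitness, Matrix.det_fin_three]

/-- The entries of `g` are algebraic integers when `u` is. -/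
theorem isIntegral_entries_unipotentWitness {u : K} (hu : IsIntegral ℤ u) (N : ℕ) (i j : Fin 3) :
    IsIntegral ℤ (unipotentWitness u N i j) := by
  have h2 : IsIntegral ℤ (2 : K) := by simpa using isIntegral_natCast (B := K) 2
  have hN : IsIntegral ℤ (N : K) := isIntegral_natCast N
  fin_cases i <;> fin_cases j <;> simp [unipotentWitness] <;>
    first
    | exact isIntegral_one
    | exact isIntegral_zero
    | exact (h2.mul hu).mul hN
    | exact (h2.mul hu).mul (hN.pow 2)
    | exact h2.mul hN

/-- The entries of `g⁻¹` are algebraic integers when `u` is. -/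
theorem isIntegral_entries_unipotentWitnessInv {u : K} (hu : IsIntegral ℤ u) (N : ℕ) (i j : Fin 3) :
    IsIntegral ℤ (unipotentWitnessInv u N i j) := by
  have h2 : IsIntegral ℤ (2 : K) := by simpa using isIntegral_natCast (B := K) 2
  have hN : IsIntegral ℤ (N : K) := isIntegral_natCast N
  fin_cases i <;> fin_cases j <;> simp [unipotentWitnessInv] <;>
    first
    | exact isIntegral_one
    | exact isIntegral_zero
    | exact (h2.mul hu).mul hN
    | exact (h2.mul hu).mul (hN.pow 2)
    | exact h2.mul hN

/-- `g = 1 + N · M` with `M = [[0, −2u, −2uN], [0, 0, 2], [0, 0, 0]]`. -/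
theorem unipotentWitness_eq_one_add_nsmul (u : K) (N : ℕ) :
    unipotentWitness u N = 1 + (N : K) • !![0, -2 * u, -2 * u * N; 0, 0, 2; 0, 0, 0] := by
  ext i j
  fin_cases i <;> fin_cases j <;> simp [unipotentWitness] <;> ring

/-- The entries of `M = (g − 1)/N` are algebraic integers when `u` is. -/
theorem isIntegral_entries_unipotentWitness_diff {u : K} (hu : IsIntegral ℤ u) (N : ℕ) (i j : Fin 3) :
    IsIntegral ℤ ((!![0, -2 * u, -2 * u * N; 0, 0, 2; 0, 0, 0] : Matrix (Fin 3) (Fin 3) K) i j) := by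
  have h2 : IsIntegral ℤ (2 : K) := by simpa using isIntegral_natCast (B := K) 2
  have hN : IsIntegral ℤ (N : K) := isIntegral_natCast N
  fin_cases i <;> fin_cases j <;> simp <;>
    first
    | exact isIntegral_zero
    | exact h2
    | exact h2.mul hu
    | exact (h2.mul hu).mul hN

/-- A matrix of the form `1 + N·M` with `M` integral is congruent to `1` modulo `N` (the `CongruentToOne`
clause of the principal congruence subgroup). -/
theorem congruentToOne_of_eq_one_add_nsmul {γ M : Matrix (Fin 3) (Fin 3) K} (N : ℕ)
    (hM : ∀ i j, IsIntegral ℤ (M i j)) (h : γ = 1 + (N : K) • M) :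
    CongruentToOne K (Ideal.span {(N : NumberField.RingOfIntegers K)}) γ := by
  intro i j
  refine ⟨(N : NumberField.RingOfIntegers K) * ⟨M i j, (mem_integralClosure_iff ℤ K).mpr (hM i j)⟩,
    Ideal.mem_span_singleton.mpr (dvd_mul_right _ _), ?_⟩
  rw [h]
  simp [Matrix.add_apply, Matrix.smul_apply]

variable [NumberField K] [NumberField.IsCMField K]

/-- `g* H_u g = H_u` for real `u` (`ρ u = u`): `g` is `H_u`-unitary. -/
theorem conjTransposeK_unipotentWitness_mul_antidiagForm_mul {u : K} (hu : ρ K u = u) (N : ℕ) :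
    conjTransposeK K (unipotentWitness u N) * antidiagForm u * unipotentWitness u N = antidiagForm u := by
  ext i j
  fin_cases i <;> fin_cases j <;>
    simp [conjTransposeK, unipotentWitness, antidiagForm, Matrix.mul_apply, Fin.sum_univ_three,
      Matrix.transpose_apply, Matrix.map_apply, hu, map_ofNat] <;>
    ring

/-- `g ∈ U(H_u)(K)` for real `u`. -/
theorem unipotentWitnessGL_mem_unitaryGroup {u : K} (hu : ρ K u = u) (N : ℕ) :
    unipotentWitnessGL u N ∈ unitaryGroup K (antidiagForm u) :=
  conjTransposeK_unipotentWitness_mul_antidiagForm_mul hu N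

/-- `g ∈ SU(H_u)(K)` for real `u`. -/
theorem unipotentWitnessGL_mem_specialUnitaryGroup {u : K} (hu : ρ K u = u) (N : ℕ) :
    unipotentWitnessGL u N ∈ specialUnitaryGroup K (antidiagForm u) := by
  refine Subgroup.mem_inf.mpr ⟨unipotentWitnessGL_mem_unitaryGroup hu N, ?_⟩
  rw [MonoidHom.mem_ker]
  ext
  simp [det_unipotentWitness]

/-- `g ∈ Γ_N = shimuraLevel K H_u 𝒪_K³ N` for `u ∈ 𝒪_K` real: `g` is special unitary, integral together with
its inverse, and `≡ 1 mod N`. -/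
theorem unipotentWitnessGL_mem_shimuraLevel {u : K} (hu : ρ K u = u) (hui : IsIntegral ℤ u) (N : ℕ) :
    unipotentWitnessGL u N ∈ shimuraLevel K (antidiagForm u) (standardLattice K 3) N := by
  rw [shimuraLevel_standardLattice]
  refine ⟨unipotentWitnessGL_mem_specialUnitaryGroup hu N, ⟨unipotentWitnessGL_mem_unitaryGroup hu N,
    isIntegral_entries_unipotentWitness hui N, isIntegral_entries_unipotentWitnessInv hui N⟩, ?_⟩
  exact congruentToOne_of_eq_one_add_nsmul N (isIntegral_entries_unipotentWitness_diff hui N)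
    (unipotentWitness_eq_one_add_nsmul u N)

omit [NumberField K] [NumberField.IsCMField K] in
/-- The matrix of `(−tiltReflectionGL t)⁻¹` is `−tiltReflection t` (the unit is its own inverse). -/
theorem coe_neg_tiltReflectionGL_inv (t : K) (ht0 : t ≠ 0) :
    ((-tiltReflectionGL t ht0)⁻¹ : GL (Fin 3) K).val = -(tiltReflection t) := rfl

omit [NumberField.IsCMField K] in
/-- `δ₄ g δ₄⁻¹ = [[1, 0, 0], [N/2, 1, 0], [−uN²/8, −uN/2, 1]]` for `δ₄ = −tiltReflection 4`. -/
theorem neg_tiltReflection_four_conj_unipotentWitness (u : K) (N : ℕ) :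
    -(tiltReflection (4 : K)) * unipotentWitness u N * -(tiltReflection (4 : K)) =
      !![1, 0, 0; (N : K) / 2, 1, 0; -(u * N ^ 2) / 8, -(u * N) / 2, 1] := by
  ext i j
  fin_cases i <;> fin_cases j <;>
    simp [tiltReflection, unipotentWitness, Matrix.mul_apply, Fin.sum_univ_three] <;>
    field_simp <;> ring

omit [NumberField.IsCMField K] in
/-- `(4 : K) ≠ 0`. -/
theorem four_ne_zero' : (4 : K) ≠ 0 := by norm_num

/-- `δ₄ = −r_{v_4}`, the tilt involution of row 155 at `t = 4`. -/
def tiltInvolutionFour : GL (Fin 3) K := -tiltReflectionGL (4 : K) four_ne_zero'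

omit [NumberField.IsCMField K] in
/-- The matrix of `δ₄` is `−tiltReflection 4`. -/
theorem coe_tiltInvolutionFour : (tiltInvolutionFour : GL (Fin 3) K).val = -(tiltReflection (4 : K)) := rfl

omit [NumberField.IsCMField K] in
/-- The matrix of `δ₄⁻¹` is `−tiltReflection 4`. -/
theorem coe_tiltInvolutionFour_inv :
    ((tiltInvolutionFour : GL (Fin 3) K)⁻¹).val = -(tiltReflection (4 : K)) := rfl

/-- `δ₄ ∈ SU(H_u)(K)` for real `u`. -/
theorem tiltInvolutionFour_mem_specialUnitaryGroup {u : K} (hu : ρ K u = u) :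
    tiltInvolutionFour ∈ specialUnitaryGroup K (antidiagForm u) :=
  neg_tiltReflectionGL_mem_specialUnitaryGroup hu (by norm_num) four_ne_zero'

omit [NumberField.IsCMField K] in
/-- `δ₄ * δ₄ = 1`. -/
theorem tiltInvolutionFour_mul_self : (tiltInvolutionFour : GL (Fin 3) K) * tiltInvolutionFour = 1 :=
  neg_tiltReflectionGL_mul_self 4 four_ne_zero'

omit [NumberField.IsCMField K] in
/-- `N/2` is not an algebraic integer for odd `N` (row 155's `not_isIntegral_two_inv`). -/
theorem not_isIntegral_half_of_odd {N : ℕ} (hN : Odd N) : ¬ IsIntegral ℤ ((N : K) / 2) := by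
  obtain ⟨k, hk⟩ := hN
  intro h
  apply not_isIntegral_two_inv (K := K)
  have hk' : IsIntegral ℤ (k : K) := isIntegral_natCast k
  have h2 : ((N : K) / 2) - (k : K) = (2 : K)⁻¹ := by
    rw [hk]; push_cast; ring
  rw [← h2]
  exact h.sub hk'

/-- `δ₄ g δ₄⁻¹ ∉ Γ_N` for odd `N`: its row `e₂ δ₄ g δ₄⁻¹ = (N/2, 1, 0)` is not integral. -/
theorem tiltInvolutionFour_conj_unipotentWitnessGL_not_mem_shimuraLevel (u : K) {N : ℕ} (hN : Odd N) :
    tiltInvolutionFour * unipotentWitnessGL u N * tiltInvolutionFour⁻¹ ∉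
      shimuraLevel K (antidiagForm u) (standardLattice K 3) N := by
  intro h
  have hx := vecMul_mem_of_mem_shimuraLevel (antidiagForm u) (standardLattice K 3) h
    (Pi.single 1 1) (single_mem_standardLattice 1)
  rw [mem_standardLattice] at hx
  have h0 := hx 0
  rw [Units.val_mul, Units.val_mul, coe_tiltInvolutionFour_inv, coe_tiltInvolutionFour,
    coe_unipotentWitnessGL, neg_tiltReflection_four_conj_unipotentWitness] at h0
  have h0' : (Matrix.vecMul (Pi.single 1 1 : Fin 3 → K)
      !![1, 0, 0; (N : K) / 2, 1, 0; -(u * N ^ 2) / 8, -(u * N) / 2, 1]) 0 = (N : K) / 2 := by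
    simp [Matrix.vecMul, dotProduct, Fin.sum_univ_three]
  rw [h0'] at h0
  exact not_isIntegral_half_of_odd hN h0

/-- `g ∉ S_{δ₄} = Γ_N ∩ δ₄⁻¹ Γ_N δ₄` (the Hecke subgroup of row 114) for odd `N`. -/
theorem unipotentWitnessGL_not_mem_heckeSubgroup (u : K) {N : ℕ} (hN : Odd N) :
    unipotentWitnessGL u N ∉ heckeSubgroup (shimuraLevelSubgroup K (antidiagForm u) (standardLattice K 3) N)
      tiltInvolutionFour := by
  intro h
  have h2 := (Subgroup.mem_inf.mp h).2
  rw [Subgroup.mem_comap] at h2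
  exact tiltInvolutionFour_conj_unipotentWitnessGL_not_mem_shimuraLevel u hN h2

/-- `δ₄` does NOT normalise `Γ_N` for odd `N` and real integral `u`: `S_{δ₄} ≠ Γ_N`. -/
theorem heckeSubgroup_tiltInvolutionFour_ne {u : K} (hu : ρ K u = u) (hui : IsIntegral ℤ u) {N : ℕ}
    (hN : Odd N) :
    heckeSubgroup (shimuraLevelSubgroup K (antidiagForm u) (standardLattice K 3) N)
        tiltInvolutionFour ≠
      shimuraLevelSubgroup K (antidiagForm u) (standardLattice K 3) N := by
  intro h
  apply unipotentWitnessGL_not_mem_heckeSubgroup u hN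
  rw [h]
  exact unipotentWitnessGL_mem_shimuraLevel hu hui N

/-- `S_{δ₄}` is a PROPER subgroup of `Γ_N`: `(S_{δ₄}).subgroupOf Γ_N ≠ ⊤`. -/
theorem heckeSubgroup_tiltInvolutionFour_subgroupOf_ne_top {u : K} (hu : ρ K u = u)
    (hui : IsIntegral ℤ u) {N : ℕ} (hN : Odd N) :
    (heckeSubgroup (shimuraLevelSubgroup K (antidiagForm u) (standardLattice K 3) N)
        tiltInvolutionFour).subgroupOf
      (shimuraLevelSubgroup K (antidiagForm u) (standardLattice K 3) N) ≠ ⊤ := by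
  intro h
  rw [Subgroup.subgroupOf_eq_top] at h
  exact unipotentWitnessGL_not_mem_heckeSubgroup u hN (h (unipotentWitnessGL_mem_shimuraLevel hu hui N))

/-- THE HECKE QUOTIENT `Γ_N / S_{δ₄}` IS NONTRIVIAL: the classes of `1` and of `g` differ. -/
theorem nontrivial_heckeQuotient_tiltInvolutionFour {u : K} (hu : ρ K u = u) (hui : IsIntegral ℤ u)
    {N : ℕ} (hN : Odd N) :
    Nontrivial (shimuraLevelSubgroup K (antidiagForm u) (standardLattice K 3) N ⧸
      (heckeSubgroup (shimuraLevelSubgroup K (antidiagForm u) (standardLattice K 3) N)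
        tiltInvolutionFour).subgroupOf
          (shimuraLevelSubgroup K (antidiagForm u) (standardLattice K 3) N)) := by
  refine ⟨⟨QuotientGroup.mk 1, QuotientGroup.mk ⟨unipotentWitnessGL u N,
    unipotentWitnessGL_mem_shimuraLevel hu hui N⟩, fun h => ?_⟩⟩
  rw [QuotientGroup.eq, inv_one, one_mul, Subgroup.mem_subgroupOf] at h
  exact unipotentWitnessGL_not_mem_heckeSubgroup u hN h

/-- `T_{δ₄}` IS A GENUINELY MULTI-COSET HECKE OPERATOR: the Hecke quotient `Γ_N / S_{δ₄}` has at least two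
elements (for odd `N` and real integral `u`), so `T_{δ₄} f = Σ_q f∥(δ₄ r_q)` on the weight-`k` forms for `Γ_N`
is a sum of at least two slashes — in contrast with the normalising involutions of rows 153–154 (a single
slash). -/
theorem two_le_card_heckeQuotient_tiltInvolutionFour {u : K} (hu : ρ K u = u) (hui : IsIntegral ℤ u)
    {N : ℕ} (hN : Odd N)
    [Fintype (shimuraLevelSubgroup K (antidiagForm u) (standardLattice K 3) N ⧸
      (heckeSubgroup (shimuraLevelSubgroup K (antidiagForm u) (standardLattice K 3) N)
        tiltInvolutionFour).subgroupOf
          (shimuraLevelSubgroup K (antidiagForm u) (standardLattice K 3) N))] :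
    2 ≤ Fintype.card (shimuraLevelSubgroup K (antidiagForm u) (standardLattice K 3) N ⧸
      (heckeSubgroup (shimuraLevelSubgroup K (antidiagForm u) (standardLattice K 3) N)
        tiltInvolutionFour).subgroupOf
          (shimuraLevelSubgroup K (antidiagForm u) (standardLattice K 3) N)) :=
  Fintype.one_lt_card_iff_nontrivial.mpr (nontrivial_heckeQuotient_tiltInvolutionFour hu hui hN)

/-- The index `[Γ_N : S_{δ₄}]` (finite by row 116's `finiteIndex_heckeSubgroup`) is at least `2`. -/
theorem one_lt_index_heckeSubgroup_tiltInvolutionFour {u : K} (hu : ρ K u = u)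
    (hui : IsIntegral ℤ u) {N : ℕ} (hN : Odd N) :
    1 < ((heckeSubgroup (shimuraLevelSubgroup K (antidiagForm u) (standardLattice K 3) N)
        tiltInvolutionFour).subgroupOf
          (shimuraLevelSubgroup K (antidiagForm u) (standardLattice K 3) N)).index := by
  haveI : ((heckeSubgroup (shimuraLevelSubgroup K (antidiagForm u) (standardLattice K 3) N)
      tiltInvolutionFour).subgroupOf
        (shimuraLevelSubgroup K (antidiagForm u) (standardLattice K 3) N)).FiniteIndex :=
    finiteIndex_heckeSubgroup isLattice_standardLattice (shimuraLevelSubgroup_le_one _ _ _)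
      (Nat.pos_iff_ne_zero.mp hN.pos) le_rfl
      ((Subgroup.mem_inf.mp (tiltInvolutionFour_mem_specialUnitaryGroup hu)).1)
  exact Subgroup.one_lt_index_of_ne_top (heckeSubgroup_tiltInvolutionFour_subgroupOf_ne_top hu hui hN)

/-- For the quasi-split model (`u ∈ 𝒪_K` real, `N` odd, `H_u = antidiag(1,u,1)`, `𝔪 = 𝒪_K³`) there is an
involution `δ ∈ SU(H_u)(K)` with `δ⁻¹ ∈ Γ_N δ Γ_N` (the double-coset condition of rows 139 / 143: `T_δ = T_{δ⁻¹}`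
wherever the Petersson space is available) whose Hecke quotient `Γ_N / S_δ` is NONTRIVIAL: a genuinely
multi-coset Hecke operator on the weight-`k` forms for `Γ_N`. -/
theorem exists_involution_multiCoset_hecke {u : K} (hu : ρ K u = u) (hui : IsIntegral ℤ u) {N : ℕ}
    (hN : Odd N) :
    ∃ δ : GL (Fin 3) K, δ ∈ specialUnitaryGroup K (antidiagForm u) ∧ δ * δ = 1 ∧
      δ⁻¹ ∈ doubleCoset (shimuraLevelSubgroup K (antidiagForm u) (standardLattice K 3) N) δ ∧
      Nontrivial (shimuraLevelSubgroup K (antidiagForm u) (standardLattice K 3) N ⧸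
        (heckeSubgroup (shimuraLevelSubgroup K (antidiagForm u) (standardLattice K 3) N) δ).subgroupOf
          (shimuraLevelSubgroup K (antidiagForm u) (standardLattice K 3) N)) :=
  ⟨tiltInvolutionFour, tiltInvolutionFour_mem_specialUnitaryGroup hu, tiltInvolutionFour_mul_self,
    inv_mem_doubleCoset_of_sq_mem (by rw [tiltInvolutionFour_mul_self]; exact Subgroup.one_mem _),
    nontrivial_heckeQuotient_tiltInvolutionFour hu hui hN⟩

end Summit.Ventures.HodgeRepro2.ShimuraData
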